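import Mathlib
import Summits.Ventures.PercRepro2.RootCutClusters
import Summits.Ventures.PercRepro2.A3CutFibres

/-!
# The two sides of a root cut: side partitions and the cluster of a vertex of the `S`-side
(blind cell PercRepro2, night-1 g33; proofs/NIGHT1-G32.md §6 and NIGHT1-G33.md, the root-shield
identity; the fibres are RootCutFibres.lean, the sums RootCutSums.lean)

Let the roots separate `VR` from `VS` (`RootCut.IsRootCut ends a₁ a₂ ↑VR ↑VS ER ES`, `VR VS : Finset V`)
and let `x ∈ VS`.
* Generic partition lemma: if on a side event `Z` the side cluster of `a` lies in `A`, the side cluster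
  events `{C_F(a) = T}`, `T ⊆ A`, partition `Z` (`sum_prob_sideEvent_cluster_inter`); the reindexing
  of a powerset sum along `insert a` (`sum_powerset_insert_eq`).
* On `Q` the cluster of `x` meets `VS ∪ {a₁, a₂}` in its `S`-cluster (`cluster_inter_S`) and meets `VR`
  in the `R`-cluster of the root `x` reaches inside `S`, or not at all (`cluster_inter_R_of_conn`,
  `cluster_inter_R_of_not_conn`); on `Q_R` the `R`-cluster of a root is the root with its part in `VR`
  (`cluster_R_root_eq`).
Standard axioms.
-/

namespace Summit.Ventures.PercRepro2

open UnionCluster CovForm CutV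

namespace CovForm

namespace A3Fibre

namespace RootShield

/-! ## Generic partition lemmas for side cluster events -/

section Partition

variable {V : Type*} {E : Type*} [Fintype V] [DecidableEq V] [Fintype E] [DecidableEq E]
  {R : Type*} [CommRing R] {ends : E → Sym2 V}

omit [Fintype V] [DecidableEq V] [Fintype E] [DecidableEq E] in
/-- The side event of the empty event is empty. -/
lemma sideEvent_empty (F : Set E) [DecidablePred (· ∈ F)] :
    sideEvent F (∅ : Set (Config E)) = ∅ := by
  ext ω
  simp [mem_sideEvent]

/-- **Partition**: if on the side event `Z` the side cluster of `a` lies in `A`, the side cluster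
events `{C_F(a) = T}`, `T ⊆ A`, partition `Z`. -/
lemma sum_prob_sideEvent_cluster_inter (p : E → R) (F : Set E) [DecidablePred (· ∈ F)] (a : V)
    (A : Finset V) (Z : Set (Config E))
    (hZ : ∀ ω : Config E, restrict F ω ∈ Z → cluster ends (restrict F ω) a ⊆ ↑A) :
    ∑ T ∈ A.powerset, prob p (sideEvent F (clusterEvent ends a (↑T : Set V) ∩ Z)) =
      prob p (sideEvent F Z) := by
  rw [Finset.sum_subset (Finset.subset_univ _)]
  · unfold prob
    rw [Finset.sum_comm]
    refine Finset.sum_congr rfl fun ω _ => ?_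
    by_cases hZω : ω ∈ sideEvent F Z
    · have key : ∀ W : Finset V,
          (sideEvent F (clusterEvent ends a (↑W : Set V) ∩ Z)).indicator (weight p) ω =
            (clusterEvent ends a (↑W : Set V)).indicator (fun _ => weight p ω) (restrict F ω) := by
        intro W
        by_cases hW : restrict F ω ∈ clusterEvent ends a (↑W : Set V)
        · rw [Set.indicator_of_mem hW, Set.indicator_of_mem]
          exact ⟨hW, hZω⟩
        · rw [Set.indicator_of_notMem hW, Set.indicator_of_notMem]
          intro hc; exact hW hc.1
      simp_rw [key]
      rw [sum_indicator_clusterEvent, Set.indicator_of_mem hZω]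
    · rw [Set.indicator_of_notMem hZω]
      refine Finset.sum_eq_zero fun W _ => ?_
      rw [Set.indicator_of_notMem]
      intro hc; exact hZω hc.2
  · intro W _ hW
    unfold prob
    refine Finset.sum_eq_zero fun ω _ => ?_
    rw [Set.indicator_of_notMem]
    intro hc
    apply hW
    rw [Finset.mem_powerset]
    intro u hu
    have hu' : u ∈ cluster ends (restrict F ω) a := by
      rw [hc.1]; exact Finset.mem_coe.2 hu
    exact Finset.mem_coe.1 (hZ ω hc.2 hu')

omit [Fintype V] [Fintype E] [DecidableEq E] in
/-- Reindexing: a sum over `T ⊆ insert a A` of a function vanishing when `a ∉ T` is the sum over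
`S ⊆ A` at `insert a S`. -/
lemma sum_powerset_insert_eq (a : V) (A : Finset V) (ha : a ∉ A) (f : Finset V → R)
    (hf : ∀ T, a ∉ T → f T = 0) :
    ∑ T ∈ (insert a A).powerset, f T = ∑ S ∈ A.powerset, f (insert a S) := by
  have hinj : Set.InjOn (fun S : Finset V => insert a S) (↑(A.powerset) : Set (Finset V)) := by
    intro S hS S' hS' heq
    simp only [Finset.coe_powerset, Set.mem_preimage] at hS hS'
    have haS : a ∉ S := fun hx => ha (hS hx)
    have haS' : a ∉ S' := fun hx => ha (hS' hx)
    have heq' : insert a S = insert a S' := heq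
    rw [← Finset.erase_insert haS, ← Finset.erase_insert haS', heq']
  have hdisj : Disjoint A.powerset (A.powerset.image (insert a)) := by
    rw [Finset.disjoint_left]
    intro S hS hS'
    rw [Finset.mem_image] at hS'
    obtain ⟨S', _, rfl⟩ := hS'
    exact ha (Finset.mem_powerset.1 hS (Finset.mem_insert_self a S'))
  have h0 : ∑ S ∈ A.powerset, f S = 0 :=
    Finset.sum_eq_zero fun S hS => hf S fun haS => ha (Finset.mem_powerset.1 hS haS)
  rw [Finset.powerset_insert, Finset.sum_union hdisj, Finset.sum_image hinj, h0, zero_add]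

end Partition

/-! ## The two sides of a root cut -/

section Sides

variable {V : Type*} {E : Type*} [DecidableEq V] {ends : E → Sym2 V} {a₁ a₂ : V} {VR VS : Finset V}
  {ER ES : Set E} [DecidablePred (· ∈ ER)] [DecidablePred (· ∈ ES)]

/-- Membership in the `S`-side with the roots, finset form. -/
lemma mem_insert_roots_iff {v : V} :
    v ∈ insert a₁ (insert a₂ VS) ↔ v ∈ (↑VS : Set V) ∪ {a₁, a₂} := by
  simp only [Finset.mem_insert, Finset.mem_coe, Set.mem_union, Set.mem_insert_iff,
    Set.mem_singleton_iff]
  tauto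

/-- The `S`-side with the roots, as a set. -/
lemma coe_insert_roots :
    (↑(insert a₁ (insert a₂ VS)) : Set V) = (↑VS : Set V) ∪ {a₁, a₂} := by
  ext v
  rw [Finset.mem_coe, mem_insert_roots_iff]

omit [DecidablePred (· ∈ ER)] [DecidablePred (· ∈ ES)] in
/-- `VS ∪ {a₁, a₂}` and `VR` are disjoint. -/
lemma disjoint_insert_roots_VR (h : RootCut.IsRootCut ends a₁ a₂ ↑VR ↑VS ER ES) :
    Disjoint (insert a₁ (insert a₂ VS)) VR := by
  rw [Finset.disjoint_left]
  intro v hv hvR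
  rcases Finset.mem_insert.1 hv with rfl | hv
  · exact h.a₁_notR (Finset.mem_coe.2 hvR)
  rcases Finset.mem_insert.1 hv with rfl | hv
  · exact h.a₂_notR (Finset.mem_coe.2 hvR)
  · exact Finset.disjoint_left.1 (Finset.disjoint_coe.1 h.disj) hvR hv

omit [DecidableEq V] [DecidablePred (· ∈ ER)] in
/-- An `S`-cluster of a vertex of `VS` does not meet `VR`. -/
lemma cluster_S_inter_VR (h : RootCut.IsRootCut ends a₁ a₂ ↑VR ↑VS ER ES) (ω : Config E) {x : V}
    (hx : x ∈ VS) : cluster ends (restrict ES ω) x ∩ ↑VR = ∅ := by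
  ext v
  simp only [Set.mem_inter_iff, Set.mem_empty_iff_false, iff_false, not_and]
  intro hv hvR
  rcases RootCut.cluster_restrict_subset_S h (Or.inl (Finset.mem_coe.2 hx)) hv with hvS | hvroot
  · exact Set.disjoint_left.1 h.disj hvR hvS
  · simp only [Set.mem_insert_iff, Set.mem_singleton_iff] at hvroot
    rcases hvroot with rfl | rfl
    · exact h.a₁_notR hvR
    · exact h.a₂_notR hvR

omit [DecidableEq V] in
/-- On `Q`, the cluster of `x ∈ VS` meets `VS ∪ {a₁, a₂}` in its `S`-cluster. -/
lemma cluster_inter_S (h : RootCut.IsRootCut ends a₁ a₂ ↑VR ↑VS ER ES) {ω : Config E}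
    (hQ : ¬ Conn ends ω a₂ a₁) {x : V} (hx : x ∈ VS) :
    cluster ends ω x ∩ ((↑VS : Set V) ∪ {a₁, a₂}) = cluster ends (restrict ES ω) x := by
  have hR : ¬ Conn ends (restrict ER ω) a₁ a₂ :=
    fun hc => ((RootCut.not_conn_iff h).1 hQ).1 (conn_symm hc)
  ext v
  simp only [Set.mem_inter_iff, mem_cluster]
  constructor
  · rintro ⟨hv, hvS⟩
    exact (RootCut.conn_iff_restrict_of_not_conn h hR (Or.inl (Finset.mem_coe.2 hx)) hvS).1 hv
  · intro hv
    exact ⟨conn_mono (restrict_le ES ω) hv,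
      RootCut.cluster_restrict_subset_S h (Or.inl (Finset.mem_coe.2 hx)) hv⟩

omit [DecidableEq V] in
/-- On `Q`, when `x ∈ VS` reaches the root `a` inside `S`, the cluster of `x` meets `VR` in the
`R`-cluster of `a`. -/
lemma cluster_inter_R_of_conn (h : RootCut.IsRootCut ends a₁ a₂ ↑VR ↑VS ER ES) {ω : Config E}
    (hQ : ¬ Conn ends ω a₂ a₁) {x a : V} (hx : x ∈ VS) (ha : a = a₁ ∨ a = a₂)
    (hxa : Conn ends (restrict ES ω) x a) :
    cluster ends ω x ∩ ↑VR = cluster ends (restrict ER ω) a ∩ ↑VR := by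
  obtain ⟨hR', hS'⟩ := (RootCut.not_conn_iff h).1 hQ
  have hR : ¬ Conn ends (restrict ER ω) a₁ a₂ := fun hc => hR' (conn_symm hc)
  have hS : ¬ Conn ends (restrict ES ω) a₁ a₂ := fun hc => hS' (conn_symm hc)
  rw [RootCut.cluster_eq_union_root h hR hS (Finset.mem_coe.2 hx) ha hxa,
    Set.union_inter_distrib_right, cluster_S_inter_VR h ω hx, Set.empty_union]

omit [DecidableEq V] in
/-- On `Q`, when `x ∈ VS` reaches no root inside `S`, the cluster of `x` does not meet `VR`. -/
lemma cluster_inter_R_of_not_conn (h : RootCut.IsRootCut ends a₁ a₂ ↑VR ↑VS ER ES) {ω : Config E}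
    (hQ : ¬ Conn ends ω a₂ a₁) {x : V} (hx : x ∈ VS) (h1 : ¬ Conn ends (restrict ES ω) x a₁)
    (h2 : ¬ Conn ends (restrict ES ω) x a₂) : cluster ends ω x ∩ ↑VR = ∅ := by
  obtain ⟨hR', hS'⟩ := (RootCut.not_conn_iff h).1 hQ
  have hR : ¬ Conn ends (restrict ER ω) a₁ a₂ := fun hc => hR' (conn_symm hc)
  have hS : ¬ Conn ends (restrict ES ω) a₁ a₂ := fun hc => hS' (conn_symm hc)
  rw [RootCut.cluster_eq_of_not_conn_roots h hR hS (Finset.mem_coe.2 hx) h1 h2,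
    cluster_S_inter_VR h ω hx]

omit [DecidableEq V] [DecidablePred (· ∈ ES)] in
/-- On `Q_R`, the `R`-cluster of a root `a` is `a` together with its part in `VR`. -/
lemma cluster_R_root_eq (h : RootCut.IsRootCut ends a₁ a₂ ↑VR ↑VS ER ES) {ω : Config E}
    (hR' : ¬ Conn ends (restrict ER ω) a₂ a₁) {a : V} (ha : a = a₁ ∨ a = a₂) :
    cluster ends (restrict ER ω) a = insert a (cluster ends (restrict ER ω) a ∩ ↑VR) := by
  have haR : a ∈ (↑VR : Set V) ∪ {a₁, a₂} := by
    rcases ha with rfl | rfl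
    · exact Or.inr (Or.inl rfl)
    · exact Or.inr (Or.inr rfl)
  ext v
  simp only [Set.mem_insert_iff, Set.mem_inter_iff]
  constructor
  · intro hv
    rcases RootCut.cluster_restrict_subset_R h haR hv with hvR | hvroot
    · exact Or.inr ⟨hv, hvR⟩
    · simp only [Set.mem_insert_iff, Set.mem_singleton_iff] at hvroot
      rcases hvroot with rfl | rfl
      · rcases ha with rfl | rfl
        · exact Or.inl rfl
        · exact absurd hv hR'
      · rcases ha with rfl | rfl
        · exact absurd (conn_symm hv) hR'
        · exact Or.inl rfl
  · rintro (rfl | ⟨hv, _⟩)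
    · exact conn_refl _ _ _
    · exact hv

omit [DecidablePred (· ∈ ER)] [DecidablePred (· ∈ ES)] in
/-- `(T ∪ W_R) ∩ (VS ∪ {a₁, a₂}) = T` for `T ⊆ VS ∪ {a₁, a₂}`, `W_R ⊆ VR`. -/
lemma union_inter_S_eq (h : RootCut.IsRootCut ends a₁ a₂ ↑VR ↑VS ER ES) {T : Finset V}
    (hT : T ⊆ insert a₁ (insert a₂ VS)) {W_R : Finset V} (hW : W_R ⊆ VR) :
    (↑(T ∪ W_R) : Set V) ∩ ((↑VS : Set V) ∪ {a₁, a₂}) = ↑T := by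
  rw [← coe_insert_roots]
  ext v
  simp only [Finset.coe_union, Set.mem_inter_iff, Set.mem_union, Finset.mem_coe]
  constructor
  · rintro ⟨hv | hv, hvS⟩
    · exact hv
    · exact absurd hvS (Finset.disjoint_right.1 (disjoint_insert_roots_VR h) (hW hv))
  · intro hv
    exact ⟨Or.inl hv, hT hv⟩

omit [DecidablePred (· ∈ ER)] [DecidablePred (· ∈ ES)] in
/-- `(T ∪ W_R) ∩ VR = W_R` for `T ⊆ VS ∪ {a₁, a₂}`, `W_R ⊆ VR`. -/
lemma union_inter_R_eq (h : RootCut.IsRootCut ends a₁ a₂ ↑VR ↑VS ER ES) {T : Finset V}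
    (hT : T ⊆ insert a₁ (insert a₂ VS)) {W_R : Finset V} (hW : W_R ⊆ VR) :
    (↑(T ∪ W_R) : Set V) ∩ ↑VR = ↑W_R := by
  ext v
  simp only [Finset.coe_union, Set.mem_inter_iff, Set.mem_union, Finset.mem_coe]
  constructor
  · rintro ⟨hv | hv, hvR⟩
    · exact absurd hvR (Finset.disjoint_left.1 (disjoint_insert_roots_VR h) (hT hv))
    · exact hv
  · intro hv
    exact ⟨Or.inr hv, hW hv⟩

omit [DecidableEq V] [DecidablePred (· ∈ ER)] [DecidablePred (· ∈ ES)] in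
/-- The cluster of `x ∈ VS` lies in `VS ∪ {a₁, a₂} ∪ VR`. -/
lemma cluster_subset_sides (h : RootCut.IsRootCut ends a₁ a₂ ↑VR ↑VS ER ES) (ω : Config E)
    {x : V} (hx : x ∈ VS) {v : V} (hv : v ∈ cluster ends ω x) :
    v ∈ (↑VS : Set V) ∪ {a₁, a₂} ∨ v ∈ (↑VR : Set V) := by
  rcases RootCut.mem_union_of_conn h (Or.inl (Or.inr (Finset.mem_coe.2 hx))) hv with
    (hvR | hvS) | hvroot
  · exact Or.inr hvR
  · exact Or.inl (Or.inl hvS)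
  · exact Or.inl (Or.inr hvroot)

end Sides

end RootShield

end A3Fibre

end CovForm

end Summit.Ventures.PercRepro2
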